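import Summits.AtomisticToContinuum.Crystallization.Theorems.TwoCentreKissingKernelRobustTangencyBoundPolygonCorner
import Literature.Geometry.DiscreteGeometry.PolygonalConeFanAngles
import HarnessLib

/-!
# `RobustTangencyBound` — splitting the corner of a polygonal facet along a diagonal (step (III), blueprint §13b)

Route `TwoCentreKissingKernel`, item `stmt-AtomisticToContinuum-12082`.  For a facet `c` of any size, a vertex `y` with
hull-edge neighbours `u ≠ w` on the facet, and any further tight point `q` of the facet, the corner of
`c` at `y` is the SUM of the two angles `∠(t_y u, t_y q) + ∠(t_y q, t_y w)`
(`cornerAngle_split`; convexity of the facet polygon via `orient3_facetVertex_pos` and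
`angle_perpTo_add`), hence the unit complex number of the corner is the PRODUCT of the two
triangle-corner numbers (`cornerZ_split`).  Consequently a planar soft facet, triangulated by any fan
of diagonals, satisfies exactly the vertex equations of the corresponding triangulated cluster, and
every factory certificate (rhombus / pentagon / hexagon / joint families) applies to it verbatim.
-/

noncomputable section

namespace Summit.AtomisticToContinuum.Crystallization.Theorems

open Real RealInnerProductSpace InnerProductGeometry Literature.Geometry.DiscreteGeometry
  Literature.Analysis.ValidatedNumerics Finset

/-- **The corner of a facet splits along a diagonal.** -/
theorem cornerAngle_split {X : Finset (EuclideanSpace ℝ (Fin 3))} (hX1 : ∀ z ∈ X, ‖z‖ = 1)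
    (h0 : (0 : EuclideanSpace ℝ (Fin 3)) ∈ interior (convexHull ℝ (X : Set (EuclideanSpace ℝ (Fin 3)))))
    {c y u w q : EuclideanSpace ℝ (Fin 3)} (hcF : c ∈ facetNormals X)
    (hy : y ∈ tightSet X c) (hu : u ∈ tightSet X c) (hw : w ∈ tightSet X c) (hq : q ∈ tightSet X c)
    (hyu : y ≠ u) (hyw : y ≠ w) (huw : u ≠ w) (hqy : q ≠ y) (hqu : q ≠ u) (hqw : q ≠ w)
    (heu : ({y, u} : Finset _) ∈ hullEdges X) (hew : ({y, w} : Finset _) ∈ hullEdges X) :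
    cornerAngle X c y = angle (perpTo y u) (perpTo y q) + angle (perpTo y q) (perpTo y w) := by
  classical
  set hc := ne_zero_of_mem_facetNormals hX1 hcF
  set m := (facetAngles X c hc).card with hm
  set v := facetVertex X c hc with hvdef
  have hm3 : 3 ≤ m := by rw [hm, card_facetAngles hX1 hc]; exact three_le_card_tightSet hcF
  have hwor : ∀ i j k, i < j → j < k → k < m → 0 < orient3 (v i) (v j) (v k) :=
    fun i j k hij hjk hk => orient3_facetVertex_pos hX1 hcF hij hjk hk
  have hinj : ∀ i i', i < m → i' < m → v i = v i' → i = i' :=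
    fun i i' hi hi' h => facetVertex_injOn hc (by rw [Finset.coe_range, Set.mem_Iio]; exact hi)
      (by rw [Finset.coe_range, Set.mem_Iio]; exact hi') h
  -- cyclically ordered triples are positively oriented
  have hcyc : ∀ a b d, a < m → b < m → d < m →
      (a < b ∧ b < d) ∨ (b < d ∧ d < a) ∨ (d < a ∧ a < b) → 0 < orient3 (v a) (v b) (v d) := by
    rintro a b d ha hb hd (⟨h1, h2⟩ | ⟨h1, h2⟩ | ⟨h1, h2⟩)
    · exact hwor a b d h1 h2 hd
    · rw [orient3_cyclic]; exact hwor b d a h1 h2 ha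
    · rw [orient3_cyclic, orient3_cyclic]; exact hwor d a b h1 h2 hb
  -- indices of y, q
  obtain ⟨j, hj, hjy⟩ := exists_facetVertex_eq hX1 hc hy
  obtain ⟨i, hi, hiq⟩ := exists_facetVertex_eq hX1 hc hq
  -- the two edges: u, w are v (j+1), v (j-1) in some order
  obtain ⟨a, ha, hau⟩ := consecutive_of_mem_hullEdges hX1 h0 hcF heu
    (by intro x hx; rw [mem_insert, mem_singleton] at hx; rcases hx with rfl | rfl <;> assumption)
  obtain ⟨b, hb, hbw⟩ := consecutive_of_mem_hullEdges hX1 h0 hcF hew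
    (by intro x hx; rw [mem_insert, mem_singleton] at hx; rcases hx with rfl | rfl <;> assumption)
  have pair_cases : ∀ {a b p r : EuclideanSpace ℝ (Fin 3)}, a ≠ b → ({a, b} : Finset _) = {p, r} →
      (a = p ∧ b = r) ∨ (a = r ∧ b = p) := by
    intro a b p r hab h
    have ha : a ∈ ({p, r} : Finset _) := by rw [← h]; simp
    have hb : b ∈ ({p, r} : Finset _) := by rw [← h]; simp
    rw [mem_insert, mem_singleton] at ha hb
    rcases ha with rfl | rfl <;> rcases hb with rfl | rfl
    · exact absurd rfl hab
    · exact Or.inl ⟨rfl, rfl⟩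
    · exact Or.inr ⟨rfl, rfl⟩
    · exact absurd rfl hab
  -- the corner itself (PolygonCorner): `∠(t u, t w)`
  have hcorner := cornerAngle_of_hullEdges hX1 h0 hcF hy hu hw hyu hyw huw heu hew
  -- s = (j+1) % m, p = (j+m-1) % m; {u, w} = {v s, v p}
  set s := (j + 1) % m with hs
  set p := (j + m - 1) % m with hp
  have hsm : s < m := Nat.mod_lt _ (by omega)
  have hpm : p < m := Nat.mod_lt _ (by omega)
  have pred_succ : ∀ i, i < m → ((i + 1) % m + m - 1) % m = i := by
    intro i hi
    rcases Nat.lt_or_ge (i + 1) m with h | h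
    · rw [Nat.mod_eq_of_lt h, show i + 1 + m - 1 = i + m by omega, Nat.add_mod_right, Nat.mod_eq_of_lt hi]
    · have : i = m - 1 := by omega
      subst this
      rw [show m - 1 + 1 = m by omega, Nat.mod_self, Nat.zero_add, Nat.mod_eq_of_lt (by omega)]
  -- from an edge {y, x} = {v a, v (a+1)}: x = v s or x = v p
  have nb : ∀ {x : EuclideanSpace ℝ (Fin 3)} {a : ℕ}, a < m → y ≠ x →
      ({y, x} : Finset _) = {v a, v ((a + 1) % m)} → x = v s ∨ x = v p := by
    intro x a ha hyx hax
    rcases pair_cases hyx hax with ⟨hya, hxa⟩ | ⟨hya, hxa⟩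
    · have : a = j := hinj a j ha hj (hya.symm.trans hjy.symm)
      subst this; exact Or.inl hxa
    · have h1 : (a + 1) % m = j := hinj _ _ (Nat.mod_lt _ (by omega)) hj (hya.symm.trans hjy.symm)
      right; rw [hxa, hp, ← h1, pred_succ a ha]
  have hu' := nb ha hyu hau
  have hw' := nb hb hyw hbw
  -- i is none of j, s, p
  have hij : i ≠ j := fun h => hqy (by rw [← hiq, ← hjy, h])
  have his : i ≠ s := by
    intro h
    rcases hu' with h1 | h1
    · exact hqu (by rw [← hiq, h, h1])
    · rcases hw' with h2 | h2
      · exact hqw (by rw [← hiq, h, h2])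
      · exact huw (h1.trans h2.symm)
  have hip : i ≠ p := by
    intro h
    rcases hu' with h1 | h1
    · rcases hw' with h2 | h2
      · exact huw (h1.trans h2.symm)
      · exact hqw (by rw [← hiq, h, h2])
    · exact hqu (by rw [← hiq, h, h1])
  -- the three orientation facts
  have key : 0 < orient3 (v j) (v s) (v i) ∧ 0 < orient3 (v j) (v i) (v p) ∧
      0 < orient3 (v j) (v s) (v p) := by
    rcases Nat.lt_or_ge (j + 1) m with hj1 | hj1
    · have hs' : s = j + 1 := by rw [hs, Nat.mod_eq_of_lt hj1]
      rcases Nat.eq_zero_or_pos j with hj0 | hj0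
      · have hp' : p = m - 1 := by rw [hp, hj0, Nat.zero_add, Nat.mod_eq_of_lt (by omega)]
        rw [hs'] at his ⊢; rw [hp'] at hip ⊢
        refine ⟨hcyc _ _ _ hj (by omega) hi ?_, hcyc _ _ _ hj hi (by omega) ?_,
          hcyc _ _ _ hj (by omega) (by omega) ?_⟩ <;> omega
      · have hp' : p = j - 1 := by
          rw [hp, show j + m - 1 = (j - 1) + m by omega, Nat.add_mod_right, Nat.mod_eq_of_lt (by omega)]
        rw [hs'] at his ⊢; rw [hp'] at hip ⊢
        refine ⟨hcyc _ _ _ hj (by omega) hi ?_, hcyc _ _ _ hj hi (by omega) ?_,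
          hcyc _ _ _ hj (by omega) (by omega) ?_⟩ <;> omega
    · have hs' : s = 0 := by rw [hs, show j + 1 = m by omega, Nat.mod_self]
      have hp' : p = j - 1 := by
        rw [hp, show j + m - 1 = (j - 1) + m by omega, Nat.add_mod_right, Nat.mod_eq_of_lt (by omega)]
      rw [hs'] at his ⊢; rw [hp'] at hip ⊢
      refine ⟨hcyc _ _ _ hj (by omega) hi ?_, hcyc _ _ _ hj hi (by omega) ?_,
        hcyc _ _ _ hj (by omega) (by omega) ?_⟩ <;> omega
  obtain ⟨k1, k2, k3⟩ := key
  have hadd := angle_perpTo_add k1 k2 k3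
  -- assemble
  have hvj : v j = y := hjy
  have hvi : v i = q := hiq
  rw [hvj, hvi] at hadd
  rw [hcorner]
  rcases hu' with h1 | h1 <;> rcases hw' with h2 | h2
  · exact absurd (h1.trans h2.symm) huw
  · rw [h1, h2]; exact hadd
  · rw [h1, h2, angle_comm, hadd, add_comm, angle_comm (perpTo y (v s)), angle_comm (perpTo y q)]
  · exact absurd (h1.trans h2.symm) huw

/-- **The corner number splits as a product.** With `α = ∠(t_y u, t_y q)`, `β = ∠(t_y q, t_y w)`:
`cornerZ X c y = (cos α + i sin α)(cos β + i sin β)`. -/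
theorem cornerZ_split {X : Finset (EuclideanSpace ℝ (Fin 3))} (hX1 : ∀ z ∈ X, ‖z‖ = 1)
    (h0 : (0 : EuclideanSpace ℝ (Fin 3)) ∈ interior (convexHull ℝ (X : Set (EuclideanSpace ℝ (Fin 3)))))
    {c y u w q : EuclideanSpace ℝ (Fin 3)} (hcF : c ∈ facetNormals X)
    (hy : y ∈ tightSet X c) (hu : u ∈ tightSet X c) (hw : w ∈ tightSet X c) (hq : q ∈ tightSet X c)
    (hyu : y ≠ u) (hyw : y ≠ w) (huw : u ≠ w) (hqy : q ≠ y) (hqu : q ≠ u) (hqw : q ≠ w)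
    (heu : ({y, u} : Finset _) ∈ hullEdges X) (hew : ({y, w} : Finset _) ∈ hullEdges X) :
    cornerZ X c y =
      ((Real.cos (angle (perpTo y u) (perpTo y q)) : ℂ) +
          (Real.sin (angle (perpTo y u) (perpTo y q)) : ℂ) * Complex.I) *
        ((Real.cos (angle (perpTo y q) (perpTo y w)) : ℂ) +
          (Real.sin (angle (perpTo y q) (perpTo y w)) : ℂ) * Complex.I) := by
  rw [cornerZ, cornerAngle_split hX1 h0 hcF hy hu hw hq hyu hyw huw hqy hqu hqw heu hew]
  set α := angle (perpTo y u) (perpTo y q)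
  set β := angle (perpTo y q) (perpTo y w)
  rw [Real.cos_add, Real.sin_add]
  push_cast
  ring_nf
  rw [Complex.I_sq]
  ring

end Summit.AtomisticToContinuum.Crystallization.Theorems

end
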